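import Mathlib
import Summits.KontsevichZagierPeriods.KontsevichZagierPeriods.Theorems.SoloInformedQShReps
import Summits.KontsevichZagierPeriods.KontsevichZagierPeriods.Theorems.SoloInformedShuffleAll
import HarnessLib
import HarnessLib.Audit

/-!
# SoloInformed — THEOREM XLVII: Hoffman's harmonic product holds in the formal period ring

Solo programme `solo-KontsevichZagierPeriods-informed`, session s47 (PROGRAMME XLVII).

In `𝒫 = KZ.FormalPeriodRing` — the free abelian group on integral representations modulo ONLY the
three Kontsevich–Zagier rules (1a) additivity of the integrand, (1b) additivity of the domain,
(2) algebraic change of variables together with Fubini — the classes `mzvClass s` of the multiple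
zeta representations satisfy, for all admissible `u`, `v`,

  `mzvClass u · mzvClass v = Σ_{w ∈ u ∗ v} mzvClass w`        (`soloInformed_mzvClass_mul_stuffle`)

where `u ∗ v = MZV.stuffle u v` is Hoffman's harmonic (stuffle) product of the Literature, with
multiplicity. The Literature proves the numerical identity `ζ(u)ζ(v) = Σ ζ(w)` by truncated nested
SUMS (`multipleZeta_mul`, Hoffman 1997, Thm 4.2); sums are not among the three rules. Here the
identity is realised by moves on INTEGRALS: both `ζ(u)`, `ζ(v)` are written as cube integrals of
chain functions `G(P_{J₁−1}, …, P_{J_k−1})` of prefix products (files `WordEnds`, `CubeWord`), the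
product cube is cut — pointwise, rule (1b) with `|QSh|` summands — according to the two-chain
identity `G(Q)·G(R) = Σ_{ω ∈ QSh} G(chain_ω(Q,R))` (file `QShChains`, a finite identity of rational
functions proved by the last-step recursion of quasi-shuffle words), and each piece is, after
sorting coordinates by block (rule (2)), the cube representation of the index `idxW u v ω` read
along the word (files `QShLabels`, `QShReps`); finally `Σ_{ω ∈ QSh} f(idxW u v ω) = Σ_{w ∈ u∗v} f w`
(file `QShWords`).

With THEOREM XLII (all shuffle relations, `soloInformed_mzvClass_mul_eq_sum_shuffleWord`) this gives
**every finite double shuffle relation in `𝒫`** (`soloInformed_mzvClass_finite_double_shuffle`):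

  `Σ_{W ∈ bw(u) ш bw(v)} mzvClass (word⁻¹ W) = Σ_{w ∈ u ∗ v} mzvClass w`.

References: Hoffman 1997, Thm 4.2 and §2; Ihara–Kaneko–Zagier 2006 §1; Kontsevich–Zagier 2001 §1.2
(the conjecture predicts that all relations among MZVs follow from the three rules; the finite
double shuffle relations now provably do).
-/

noncomputable section

open Finset
open Literature.NumberTheory.Transcendental
open Literature.NumberTheory.Transcendental.KZ
open Literature.NumberTheory.Transcendental.KZ.FormalPeriodRing

namespace Summit.KontsevichZagierPeriods.KontsevichZagierPeriods.Theorems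

/-- **THEOREM XLVII (the harmonic product formula in `𝒫`).** For admissible `u`, `v`,

  `mzvClass u · mzvClass v = ((u ∗ v).map mzvClass).sum`

in the formal period ring, `u ∗ v = MZV.stuffle u v` Hoffman's harmonic product (with
multiplicity) — by the three Kontsevich–Zagier rules alone.
[Hoffman 1997 Thm 4.2 (numerically); Kontsevich–Zagier 2001 §1.2] -/
theorem soloInformed_mzvClass_mul_stuffle {u v : List ℕ} (hu : MZV.IsAdmissible u)
    (hv : MZV.IsAdmissible v) :
    mzvClass u * mzvClass v = ((MZV.stuffle u v).map mzvClass).sum := by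
  by_cases hu0 : u = []
  · subst hu0
    simp
  by_cases hv0 : v = []
  · subst hv0
    simp
  obtain ⟨k, hku⟩ : ∃ k, u.length = k + 1 :=
    Nat.exists_eq_succ_of_ne_zero (by rwa [Ne, List.length_eq_zero_iff])
  obtain ⟨k', hkv⟩ : ∃ k', v.length = k' + 1 :=
    Nat.exists_eq_succ_of_ne_zero (by rwa [Ne, List.length_eq_zero_iff])
  -- an admissible nonempty index has positive weight (inlined; both factors)
  have hwpos : ∀ {w : List ℕ}, MZV.IsAdmissible w → w ≠ [] → 0 < MZV.weight w := by
    intro w hw hne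
    obtain ⟨a, w', rfl⟩ := List.exists_cons_of_ne_nil hne
    have ha := hw.1 a (by simp)
    unfold MZV.weight
    rw [List.sum_cons]
    omega
  obtain ⟨m, hwu⟩ : ∃ m, MZV.weight u = m + 1 :=
    Nat.exists_eq_succ_of_ne_zero (hwpos hu hu0).ne'
  obtain ⟨m', hwv⟩ : ∃ m', MZV.weight v = m' + 1 :=
    Nat.exists_eq_succ_of_ne_zero (hwpos hv hv0).ne'
  rw [soloInformed_sum_stuffle_qSh mzvClass u v, hku, hkv]
  exact soloInformed_mzvClass_mul_qSh_raw hu hwu hku hv hwv hkv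

/-- **COROLLARY (all finite double shuffle relations hold in `𝒫`).** For admissible `u`, `v`, the
shuffle product of the binary words and the harmonic product of the indices have the same sum of
classes: `Σ_{W ∈ bw(u) ш bw(v)} mzvClass (word⁻¹ W) = Σ_{w ∈ u ∗ v} mzvClass w`.
[Ihara–Kaneko–Zagier 2006 §1, finite double shuffle; KZ 2001 §1.2] -/
theorem soloInformed_mzvClass_finite_double_shuffle {u v : List ℕ} (hu : MZV.IsAdmissible u)
    (hv : MZV.IsAdmissible v) :
    ((MZV.shuffleWord (MZV.binaryWord u) (MZV.binaryWord v)).map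
        fun W => mzvClass (MZV.ofBinaryWord W)).sum = ((MZV.stuffle u v).map mzvClass).sum := by
  rw [← soloInformed_mzvClass_mul_eq_sum_shuffleWord hu hv, soloInformed_mzvClass_mul_stuffle hu hv]

/-- **COROLLARY (the formal MZV algebra is weight-graded for `·`).** The product of two multiple
zeta classes is an `ℕ`-combination of multiple zeta classes of the total weight. -/
theorem soloInformed_mzvClass_mul_mem_span {u v : List ℕ} (hu : MZV.IsAdmissible u)
    (hv : MZV.IsAdmissible v) :
    mzvClass u * mzvClass v ∈ AddSubmonoid.closure
      (mzvClass '' {w | MZV.IsAdmissible w ∧ MZV.weight w = MZV.weight u + MZV.weight v}) := by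
  rw [soloInformed_mzvClass_mul_stuffle hu hv]
  refine list_sum_mem fun z hz => ?_
  obtain ⟨w, hw, rfl⟩ := List.mem_map.mp hz
  refine AddSubmonoid.subset_closure ⟨w, ⟨MZV.isAdmissible_of_mem_stuffle hu hv hw, ?_⟩, rfl⟩
  unfold MZV.weight
  exact MZV.sum_of_mem_stuffle u v hw

/-- The numerical shadow: applying `evalP` recovers Hoffman's Theorem 4.2 of the Literature
(`multipleZeta_mul`), now as a consequence of the three rules. -/
theorem soloInformed_evalP_mzvClass_mul {u v : List ℕ} (hu : MZV.IsAdmissible u)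
    (hv : MZV.IsAdmissible v) :
    evalP (mzvClass u * mzvClass v) = ((MZV.stuffle u v).map multipleZeta).sum := by
  rw [soloInformed_mzvClass_mul_stuffle hu hv, map_list_sum, List.map_map]
  congr 1
  refine List.map_congr_left fun w hw => ?_
  exact evalP_mzvClass (MZV.isAdmissible_of_mem_stuffle hu hv hw)

/-! ## Examples -/

/-- `Z(2,1)·Z(3) = Z(2,1,3) + Z(2,3,1) + Z(2,4) + Z(3,2,1) + Z(5,1)` in `𝒫`. -/
example : mzvClass [2, 1] * mzvClass [3] =
    mzvClass [2, 1, 3] + mzvClass [2, 3, 1] + mzvClass [2, 4] + mzvClass [3, 2, 1] +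
      mzvClass [5, 1] := by
  rw [soloInformed_mzvClass_mul_stuffle (by decide) (by decide)]
  simp [MZV.stuffle_cons_cons]
  abel

/-- `Z(3)·Z(2) = Z(3,2) + Z(2,3) + Z(5)` in `𝒫` (Euler's decomposition meets the harmonic
product: compare `Z(3)·Z(2) = Z(3,2) + 3Z(4,1) + … ` from the shuffle side, THEOREM XLII). -/
example : mzvClass [3] * mzvClass [2] = mzvClass [3, 2] + mzvClass [2, 3] + mzvClass [5] := by
  rw [soloInformed_mzvClass_mul_stuffle (by decide) (by decide)]
  simp [MZV.stuffle_cons_cons]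
  abel

end Summit.KontsevichZagierPeriods.KontsevichZagierPeriods.Theorems
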